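import Literature.Analysis.FluidPDE.PassiveVectorTensorGarding
import Literature.Analysis.FluidPDE.PassiveVectorTensorDistortedDuality
import HarnessLib

/-!
# The divergence-form test operator with VARIABLE coefficients `viscAdjVar 𝔹`: energy-form
# identity (one integration by parts) and the perturbative Gårding inequality on divergence-free fields

Analysis/FluidPDE proof-support file (everything proved; no definitions, no named facts).

For a smooth tensor FIELD `𝔹 : T^d → Visc4 d` (every coefficient `y ↦ 𝔹 y i c j e` smooth) the
divergence-form adjoint viscous operator of `PassiveVectorTensorDistorted`,
`(viscAdjVar 𝔹 Ψ)_j = Σ_{i,c,e} ∂_e(𝔹 i c j e · ∂_c Ψ_i)` — Giaquinta's variable-coefficient system in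
divergence form `−D_α(A^{αβ}_{ij}(x) D_β u^j)` put on the test side — satisfies, on smooth vector fields
of the flat torus (empty boundary, Evans App. C.2 Thm. 2):

* §1 smoothness of `viscAdjVar 𝔹 Ψ` and the splitting `viscAdjVar 𝔹 = viscAdj 𝔸 + viscAdjVar (𝔹 − 𝔸)`
  (additivity `viscAdjVar_add_tensor` is the tree's, `PassiveVectorTensorDistortedDuality`);
* §2 **the energy-form identity** `integral_inner_viscAdjVar_eq_neg`:
  `∫ ⟪φ, viscAdjVar 𝔹 ψ⟫ = −∫ Σ_{icje} 𝔹(x) i c j e (∂_c ψ)_i (∂_e φ)_j` (ONE integration by parts per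
  coefficient; Giaquinta Ch. III §2 (2.3): the bilinear form `∫ A^{αβ}_{ij} D_β u^j D_α φ^i`), and its
  diagonal `integral_inner_viscAdjVar_self_eq_neg_gradForm` (`φ = ψ`, energy form `Torus.gradForm (𝔹 x)`);
* §3 **the perturbative Gårding inequality** `integral_inner_viscAdjVar_self_le`: if `𝔸` is a
  CONSTANT tensor in a Legendre–Hadamard window `NearIso 𝔸 lo hi` and the field is entrywise close to
  it, `|𝔹(y) i c j e − 𝔸 i c j e| ≤ δ`, then for every smooth DIVERGENCE-FREE `ψ`
  `∫ ⟪ψ, viscAdjVar 𝔹 ψ⟫ ≤ −(lo − (card d)² δ) ‖∇ψ‖₂²`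
  — the tree's Fourier Gårding inequality for the constant part
  (`PassiveVectorTensorGarding.integral_inner_viscAdj_self_le`, Giaquinta (2.2) ⇒ (2.6)) plus the
  pointwise bound `|Σ (𝔹−𝔸) ξ ξ| ≤ δ (Σ|ξ|)² ≤ δ d² |ξ|²` (Cauchy–Schwarz) on the perturbation; this is
  Gårding's inequality for coefficients that are a small `L^∞` perturbation of constant
  Legendre–Hadamard ones (Giaquinta Ch. III §2, remark after (2.6): uniformly continuous coefficients
  by freezing), in the explicit entrywise form requested by the consumer; nonnegative-window and
  space–time corollaries (`…_self_nonpos`, `setIntegral_integral_inner_viscAdjVar_self_nonpos`).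

Consumer: cell `ad-ideate`, K1L_D `stmt-AnomalousDissipation-27980`, lead memo L9 §5 bricks Z7α
(the adapted coarse problem `T_ad`: variable tensor `J(k̄_m R)Jᵀ ∘ X⁻¹ = k̄_m R + O(θ k̄_m hi)`) and
Z7β (two coarse problems with `O(θ)`-close tensors); class `Torus.IsWeakVarTensorPassiveVectorOn`
(`PassiveVectorVarTensor`, not imported here). Tenure ruling 2026-08-29T02:36:59Z fixed the
hypothesis shape `∀ y i c j e, |𝔹 y i c j e − 𝔸 i c j e| ≤ δ`, `(card d)²·δ ≤ lo`.

## Mathlib / tree search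

Tree: `viscAdjVar`, `viscAdjVar_apply`, `viscAdjVar_const` (`PassiveVectorTensorDistorted`),
`viscAdjVar_add_tensor`, `integral_inner_viscAdjVar_eq_neg_integral_sum` (weak-gradient form of §2),
`Visc4.form_bound_of_entry_bound`, `continuous_uncurry_viscAdjVar` (`PassiveVectorTensorDistortedDuality`),
`integral_inner_viscAdj_self_le`, `gradNormSq_nonneg` (`PassiveVectorTensorGarding`, `TorusFluidGlue`),
`gradForm` (`PassiveVectorTensor`), `partialDeriv_add/_mul/_apply_coord`, `integral_partialDeriv_eq_zero_holds`,
`IsSmooth.apply/.partialDeriv` (`FunctionSpaces/Torus*`); `rg "viscAdjVar" Literature`: only the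
definition file and its `G ≡ 1` reductions (2026-08-29). Mathlib: `sq_sum_le_card_mul_sum_sq`,
`EuclideanSpace.norm_sq_eq`, `Finset.abs_sum_le_sum_abs`, `integral_mono`, `setIntegral_nonpos`.

## References

* M. Giaquinta, *Multiple integrals in the calculus of variations and nonlinear elliptic systems*
  (Princeton 1983), Ch. III §2 (2.1)–(2.6). [`Giaquinta1983MultipleIntegrals`]
* J.-L. Lions, E. Magenes, *Non-homogeneous boundary value problems and applications* I (Springer
  1972), Chap. 3, §4.3 (4.19)–(4.21). [`LionsMagenes1972`]
* L. C. Evans, *Partial Differential Equations*, 2nd ed. (AMS 2010), App. C.2 Thm. 2. [`Evans2010`]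
* S. Armstrong, V. Vicol, arXiv:2305.05048, §4.1 (the slowly varying correction `s_{m−1}`), PDF p. 34. [`ArmstrongVicol2025`]
-/

noncomputable section

open MeasureTheory Set Filter Function TopologicalSpace
open scoped ENNReal NNReal InnerProductSpace Topology

namespace Literature.Analysis.FluidPDE

namespace Torus

variable {d : Type*} [Fintype d] [DecidableEq d]

/-! ## §1 Smooth coefficient fields: the product rule inside `viscAdjVar` and additivity -/

section Algebra

/-- The elementary integrand `y ↦ 𝔹(y) i c j e · (∂_c Ψ)(y)_i` is smooth for smooth coefficients and
a smooth field. [cite: Giaquinta1983MultipleIntegrals, Ch. III §2 eq. (2.1)-(2.3)] -/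
theorem isSmooth_coeff_mul_partialDeriv {𝔹 : UnitAddTorus d → Visc4 d}
    (h𝔹 : ∀ i c j e, FunctionSpaces.Torus.IsSmooth (fun y => 𝔹 y i c j e))
    {Ψ : UnitAddTorus d → EuclideanSpace ℝ d} (hΨ : FunctionSpaces.Torus.IsSmooth Ψ) (i c j e : d) :
    FunctionSpaces.Torus.IsSmooth (fun y => 𝔹 y i c j e * (FunctionSpaces.Torus.partialDeriv c Ψ y) i) := by
  have h1 : FunctionSpaces.Torus.IsSmooth (fun y => (FunctionSpaces.Torus.partialDeriv c Ψ y) i) :=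
    (hΨ.partialDeriv c).apply i
  have h0 := h𝔹 i c j e
  unfold FunctionSpaces.Torus.IsSmooth at h0 h1 ⊢
  exact h0.mul h1

/-- Coordinates of `viscAdjVar` with the product rule carried out:
`(viscAdjVar 𝔹 Ψ)(x)_l = Σ_{i,c,e} (𝔹(x) i c l e · ∂_e((∂_c Ψ)_i)(x) + ∂_e(𝔹 i c l e)(x) · (∂_c Ψ)(x)_i)`.
[cite: Giaquinta1983MultipleIntegrals, Ch. III §2 eq. (2.1)-(2.3)] -/
theorem viscAdjVar_apply_eq_sum {𝔹 : UnitAddTorus d → Visc4 d}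
    (h𝔹 : ∀ i c j e, FunctionSpaces.Torus.IsSmooth (fun y => 𝔹 y i c j e))
    {Ψ : UnitAddTorus d → EuclideanSpace ℝ d} (hΨ : FunctionSpaces.Torus.IsSmooth Ψ) (x : UnitAddTorus d)
    (l : d) :
    viscAdjVar 𝔹 Ψ x l = ∑ i, ∑ c, ∑ e,
      (𝔹 x i c l e * FunctionSpaces.Torus.partialDeriv e (fun y => (FunctionSpaces.Torus.partialDeriv c Ψ y) i) x +
        FunctionSpaces.Torus.partialDeriv e (fun y => 𝔹 y i c l e) x *
          (FunctionSpaces.Torus.partialDeriv c Ψ x) i) := by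
  rw [viscAdjVar_apply]
  refine Finset.sum_congr rfl fun i _ => Finset.sum_congr rfl fun c _ => Finset.sum_congr rfl fun e _ => ?_
  have ha : FunctionSpaces.Torus.IsContDiff 1 (fun y => 𝔹 y i c l e) := (h𝔹 i c l e).isContDiff (by simp)
  have hb : FunctionSpaces.Torus.IsContDiff 1 (fun y => (FunctionSpaces.Torus.partialDeriv c Ψ y) i) :=
    ((hΨ.partialDeriv c).apply i).isContDiff (by simp)
  exact FunctionSpaces.Torus.partialDeriv_mul ha hb e x

omit [DecidableEq d] in
/-- A field minus a constant tensor has smooth coefficients when the field does.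
[cite: Giaquinta1983MultipleIntegrals, Ch. III §2 eq. (2.1)-(2.3)] -/
theorem isSmooth_coeff_sub_const {𝔹 : UnitAddTorus d → Visc4 d}
    (h𝔹 : ∀ i c j e, FunctionSpaces.Torus.IsSmooth (fun y => 𝔹 y i c j e)) (𝔸 : Visc4 d) (i c j e : d) :
    FunctionSpaces.Torus.IsSmooth (fun y => (𝔹 y - 𝔸) i c j e) := by
  have h0 := h𝔹 i c j e
  have e1 : (fun y => (𝔹 y - 𝔸) i c j e) = fun y => 𝔹 y i c j e - 𝔸 i c j e := by
    funext y; simp only [Pi.sub_apply]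
  rw [e1]
  unfold FunctionSpaces.Torus.IsSmooth at h0 ⊢
  exact h0.sub contDiff_const

/-- **Splitting off a constant tensor**: `viscAdjVar 𝔹 Ψ = viscAdj 𝔸 Ψ + viscAdjVar (𝔹 − 𝔸) Ψ` on smooth
fields (additivity and `viscAdjVar_const`). [cite: Giaquinta1983MultipleIntegrals, Ch. III §2 eq. (2.1)-(2.3)] -/
theorem viscAdjVar_eq_viscAdj_add {𝔹 : UnitAddTorus d → Visc4 d}
    (h𝔹 : ∀ i c j e, FunctionSpaces.Torus.IsSmooth (fun y => 𝔹 y i c j e)) (𝔸 : Visc4 d)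
    {Ψ : UnitAddTorus d → EuclideanSpace ℝ d} (hΨ : FunctionSpaces.Torus.IsSmooth Ψ) (x : UnitAddTorus d) :
    viscAdjVar 𝔹 Ψ x = viscAdj 𝔸 Ψ x + viscAdjVar (fun y => 𝔹 y - 𝔸) Ψ x := by
  have hc : ∀ i c j e, FunctionSpaces.Torus.IsContDiff 1 (fun _ : UnitAddTorus d => 𝔸 i c j e) :=
    fun _ _ _ _ => (FunctionSpaces.Torus.isSmooth_const _).isContDiff (by simp)
  have hP : ∀ i c j e, FunctionSpaces.Torus.IsContDiff 1 (fun y => (𝔹 y - 𝔸) i c j e) :=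
    fun i c j e => (isSmooth_coeff_sub_const h𝔹 𝔸 i c j e).isContDiff (by simp)
  have e : 𝔹 = fun y => 𝔸 + (𝔹 y - 𝔸) := by
    funext y; rw [add_sub_cancel]
  conv_lhs => rw [e]
  rw [viscAdjVar_add_tensor (𝔹₁ := fun _ => 𝔸) (𝔹₂ := fun y => 𝔹 y - 𝔸) hc hP hΨ, viscAdjVar_const 𝔸 hΨ]

end Algebra

/-! ## §2 The energy-form identity: one integration by parts -/

section EnergyForm

/-- Integration by parts on the torus, scalar form: `∫ h (∂ᵢ f) = −∫ (∂ᵢ h) f` for smooth real `f`, `h`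
(`∫ ∂ᵢ(fh) = 0`). [cite: Evans2010, App. C.2 Thm. 2] -/
private theorem integral_mul_partialDeriv_eq_neg₂₈ {f h : UnitAddTorus d → ℝ}
    (hf : FunctionSpaces.Torus.IsSmooth f) (hh : FunctionSpaces.Torus.IsSmooth h) (i : d) :
    ∫ x, h x * FunctionSpaces.Torus.partialDeriv i f x =
      -∫ x, FunctionSpaces.Torus.partialDeriv i h x * f x := by
  have hfh : FunctionSpaces.Torus.IsSmooth (fun y => h y * f y) := by
    unfold FunctionSpaces.Torus.IsSmooth at hf hh ⊢; exact hh.mul hf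
  have h0 : ∫ x, FunctionSpaces.Torus.partialDeriv i (fun y => h y * f y) x = 0 :=
    FunctionSpaces.Torus.integral_partialDeriv_eq_zero_holds hfh i
  have e : (fun x => FunctionSpaces.Torus.partialDeriv i (fun y => h y * f y) x) =
      fun x => h x * FunctionSpaces.Torus.partialDeriv i f x +
        FunctionSpaces.Torus.partialDeriv i h x * f x :=
    funext fun x => FunctionSpaces.Torus.partialDeriv_mul (hh.isContDiff (by simp))
      (hf.isContDiff (by simp)) i x
  have hi1 : Integrable (fun x => h x * FunctionSpaces.Torus.partialDeriv i f x) volume :=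
    (hh.continuous.mul (hf.partialDeriv i).continuous).integrable_unitAddTorus
  have hi2 : Integrable (fun x => FunctionSpaces.Torus.partialDeriv i h x * f x) volume :=
    ((hh.partialDeriv i).continuous.mul hf.continuous).integrable_unitAddTorus
  rw [e, integral_add hi1 hi2] at h0
  linarith

/-- **The energy-form identity for the divergence-form test operator** (one integration by parts per
coefficient, empty boundary): for smooth coefficients `𝔹` and smooth vector fields `φ`, `ψ`,
`∫ ⟪φ, viscAdjVar 𝔹 ψ⟫ = −∫ Σ_{i,c,j,e} 𝔹(x) i c j e · (∂_c ψ)(x)_i · (∂_e φ)(x)_j` — the bilinear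
form `∫ A^{αβ}_{ij}(x) D_β u^j D_α φ^i` of the weak formulation.
[cite: Giaquinta1983MultipleIntegrals, Ch. III §2 eq. (2.3)] [cite: Evans2010, App. C.2 Thm. 2] -/
theorem integral_inner_viscAdjVar_eq_neg {𝔹 : UnitAddTorus d → Visc4 d}
    (h𝔹 : ∀ i c j e, FunctionSpaces.Torus.IsSmooth (fun y => 𝔹 y i c j e))
    {φ ψ : UnitAddTorus d → EuclideanSpace ℝ d} (hφ : FunctionSpaces.Torus.IsSmooth φ)
    (hψ : FunctionSpaces.Torus.IsSmooth ψ) :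
    ∫ x, ⟪φ x, viscAdjVar 𝔹 ψ x⟫_ℝ =
      -∫ x, ∑ i, ∑ c, ∑ j, ∑ e, 𝔹 x i c j e * (FunctionSpaces.Torus.partialDeriv c ψ x) i *
        (FunctionSpaces.Torus.partialDeriv e φ x) j := by
  -- elementary integrands
  set H : d → d → d → d → UnitAddTorus d → ℝ := fun i c j e y =>
    𝔹 y i c j e * (FunctionSpaces.Torus.partialDeriv c ψ y) i with hH
  have hHs : ∀ i c j e, FunctionSpaces.Torus.IsSmooth (H i c j e) := fun i c j e =>
    isSmooth_coeff_mul_partialDeriv h𝔹 hψ i c j e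
  set F : d → d → d → d → UnitAddTorus d → ℝ := fun i c j e x =>
    φ x j * FunctionSpaces.Torus.partialDeriv e (H i c j e) x with hF
  set G : d → d → d → d → UnitAddTorus d → ℝ := fun i c j e x =>
    𝔹 x i c j e * (FunctionSpaces.Torus.partialDeriv c ψ x) i * (FunctionSpaces.Torus.partialDeriv e φ x) j with hG
  -- pointwise expansion of the left pairing: `Σ_j φ_j (Σ_{ice} ∂_e H_{icje}) = Σ_{icje} F`
  have hL : ∀ x, ⟪φ x, viscAdjVar 𝔹 ψ x⟫_ℝ = ∑ i, ∑ c, ∑ j, ∑ e, F i c j e x := by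
    intro x
    rw [PiLp.inner_apply]
    have e1 : ∀ j, ⟪φ x j, viscAdjVar 𝔹 ψ x j⟫_ℝ = ∑ i, ∑ c, ∑ e, F i c j e x := by
      intro j
      rw [viscAdjVar_apply]
      simp only [hF, hH, RCLike.inner_apply, conj_trivial, Finset.sum_mul]
      refine Finset.sum_congr rfl fun i _ => Finset.sum_congr rfl fun c _ =>
        Finset.sum_congr rfl fun e _ => by ring
    simp_rw [e1]
    rw [Finset.sum_comm]
    exact Finset.sum_congr rfl fun i _ => Finset.sum_comm
  -- integrability of the elementary integrands
  have hFi : ∀ i c j e, Integrable (F i c j e) volume := fun i c j e =>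
    ((hφ.apply j).continuous.mul ((hHs i c j e).partialDeriv e).continuous).integrable_unitAddTorus
  have hGi : ∀ i c j e, Integrable (G i c j e) volume := fun i c j e =>
    (((hHs i c j e).continuous).mul ((hφ.partialDeriv e).apply j).continuous).integrable_unitAddTorus
  -- each elementary integral: one integration by parts
  have hIBP : ∀ i c j e, ∫ x, F i c j e x = -∫ x, G i c j e x := by
    intro i c j e
    have h1 := integral_mul_partialDeriv_eq_neg₂₈ (hHs i c j e) (hφ.apply j) e
    simp only [hF]
    rw [h1]
    congr 1
    refine integral_congr_ae (ae_of_all _ fun x => ?_)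
    simp only [hG, hH]
    rw [FunctionSpaces.Torus.partialDeriv_apply_coord (hφ.isContDiff (by simp)) e x j]
    ring
  -- swap integral and finite sums on both sides
  have hLint : ∫ x, ⟪φ x, viscAdjVar 𝔹 ψ x⟫_ℝ = ∑ i, ∑ c, ∑ j, ∑ e, ∫ x, F i c j e x := by
    rw [integral_congr_ae (ae_of_all _ hL)]
    rw [integral_finsetSum _ fun i _ => integrable_finsetSum _ fun c _ =>
      integrable_finsetSum _ fun j _ => integrable_finsetSum _ fun e _ => hFi i c j e]
    refine Finset.sum_congr rfl fun i _ => ?_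
    rw [integral_finsetSum _ fun c _ => integrable_finsetSum _ fun j _ =>
      integrable_finsetSum _ fun e _ => hFi i c j e]
    refine Finset.sum_congr rfl fun c _ => ?_
    rw [integral_finsetSum _ fun j _ => integrable_finsetSum _ fun e _ => hFi i c j e]
    refine Finset.sum_congr rfl fun j _ => ?_
    rw [integral_finsetSum _ fun e _ => hFi i c j e]
  have hRint : ∫ x, ∑ i, ∑ c, ∑ j, ∑ e, G i c j e x = ∑ i, ∑ c, ∑ j, ∑ e, ∫ x, G i c j e x := by
    rw [integral_finsetSum _ fun i _ => integrable_finsetSum _ fun c _ =>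
      integrable_finsetSum _ fun j _ => integrable_finsetSum _ fun e _ => hGi i c j e]
    refine Finset.sum_congr rfl fun i _ => ?_
    rw [integral_finsetSum _ fun c _ => integrable_finsetSum _ fun j _ =>
      integrable_finsetSum _ fun e _ => hGi i c j e]
    refine Finset.sum_congr rfl fun c _ => ?_
    rw [integral_finsetSum _ fun j _ => integrable_finsetSum _ fun e _ => hGi i c j e]
    refine Finset.sum_congr rfl fun j _ => ?_
    rw [integral_finsetSum _ fun e _ => hGi i c j e]
  have eG : (fun x => ∑ i, ∑ c, ∑ j, ∑ e, 𝔹 x i c j e * (FunctionSpaces.Torus.partialDeriv c ψ x) i *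
      (FunctionSpaces.Torus.partialDeriv e φ x) j) = fun x => ∑ i, ∑ c, ∑ j, ∑ e, G i c j e x := rfl
  rw [hLint, eG, hRint]
  simp only [hIBP, Finset.sum_neg_distrib]

/-- **Diagonal of the energy-form identity**: `∫ ⟪ψ, viscAdjVar 𝔹 ψ⟫ = −∫ E_{𝔹(x)}(∇ψ)` with the
energy form `gradForm (𝔹 x) ξ`, `ξ i c = (∂_c ψ)(x)_i`.
[cite: Giaquinta1983MultipleIntegrals, Ch. III §2 eq. (2.3)] [cite: Evans2010, App. C.2 Thm. 2] -/
theorem integral_inner_viscAdjVar_self_eq_neg_gradForm {𝔹 : UnitAddTorus d → Visc4 d}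
    (h𝔹 : ∀ i c j e, FunctionSpaces.Torus.IsSmooth (fun y => 𝔹 y i c j e))
    {ψ : UnitAddTorus d → EuclideanSpace ℝ d} (hψ : FunctionSpaces.Torus.IsSmooth ψ) :
    ∫ x, ⟪ψ x, viscAdjVar 𝔹 ψ x⟫_ℝ =
      -∫ x, gradForm (𝔹 x) (fun i c => (FunctionSpaces.Torus.partialDeriv c ψ x) i) := by
  rw [integral_inner_viscAdjVar_eq_neg h𝔹 hψ hψ]
  rfl

end EnergyForm

/-! ## §3 The perturbative Gårding inequality on divergence-free fields -/

section Garding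

omit [DecidableEq d] in
/-- Pointwise bound on the perturbation: if `|ℙ i c j e| ≤ δ` entrywise then
`|Σ_{icje} ℙ i c j e ξ_{ic} ξ_{je}| ≤ δ · (card d)² · Σ_{ic} ξ_{ic}²` (Cauchy–Schwarz on `d × d` terms).
[cite: Giaquinta1983MultipleIntegrals, Ch. III §2 eq. (2.2)–(2.6)] -/
theorem abs_gradForm_le_of_entry_le {ℙ : Visc4 d} {δ : ℝ} (hδ : ∀ i c j e, |ℙ i c j e| ≤ δ)
    (ξ : d → d → ℝ) :
    |gradForm ℙ ξ| ≤ δ * (Fintype.card d : ℝ) ^ 2 * ∑ i, ∑ c, ξ i c ^ 2 := by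
  -- `|Σ ℙ ξ ξ| ≤ δ Σ_{icje} |ξ_ic| |ξ_je| = δ (Σ_ic |ξ_ic|)²`
  set S : ℝ := ∑ i, ∑ c, |ξ i c| with hS
  have hS0 : 0 ≤ S := Finset.sum_nonneg fun i _ => Finset.sum_nonneg fun c _ => abs_nonneg _
  have h1 : |gradForm ℙ ξ| ≤ δ * S ^ 2 := by
    unfold gradForm
    calc |∑ i, ∑ a, ∑ j, ∑ b, ℙ i a j b * ξ i a * ξ j b|
        ≤ ∑ i, ∑ a, ∑ j, ∑ b, |ℙ i a j b * ξ i a * ξ j b| := by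
          refine (Finset.abs_sum_le_sum_abs _ _).trans (Finset.sum_le_sum fun i _ => ?_)
          refine (Finset.abs_sum_le_sum_abs _ _).trans (Finset.sum_le_sum fun a _ => ?_)
          refine (Finset.abs_sum_le_sum_abs _ _).trans (Finset.sum_le_sum fun j _ => ?_)
          exact Finset.abs_sum_le_sum_abs _ _
      _ ≤ ∑ i, ∑ a, ∑ j, ∑ b, δ * (|ξ i a| * |ξ j b|) := by
          refine Finset.sum_le_sum fun i _ => Finset.sum_le_sum fun a _ =>
            Finset.sum_le_sum fun j _ => Finset.sum_le_sum fun b _ => ?_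
          rw [abs_mul, abs_mul, mul_assoc]
          exact mul_le_mul_of_nonneg_right (hδ i a j b) (mul_nonneg (abs_nonneg _) (abs_nonneg _))
      _ = δ * S ^ 2 := by
          rw [hS, sq, Finset.sum_mul_sum, Finset.mul_sum]
          refine Finset.sum_congr rfl fun i _ => ?_
          rw [Finset.sum_comm, Finset.mul_sum]
          refine Finset.sum_congr rfl fun j _ => ?_
          rw [Finset.sum_mul_sum, Finset.mul_sum]
          refine Finset.sum_congr rfl fun a _ => ?_
          rw [Finset.mul_sum]
  -- `S² ≤ d · Σ_i (Σ_c |ξ_ic|)² ≤ d² Σ_ic ξ_ic²`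
  have h2 : S ^ 2 ≤ (Fintype.card d : ℝ) ^ 2 * ∑ i, ∑ c, ξ i c ^ 2 := by
    calc S ^ 2 ≤ (Finset.univ.card : ℝ) * ∑ i, (∑ c, |ξ i c|) ^ 2 := by
          have := sq_sum_le_card_mul_sum_sq (s := (Finset.univ : Finset d)) (f := fun i => ∑ c, |ξ i c|)
          exact_mod_cast this
      _ ≤ (Finset.univ.card : ℝ) * ∑ i, ((Finset.univ.card : ℝ) * ∑ c, |ξ i c| ^ 2) := by
          refine mul_le_mul_of_nonneg_left (Finset.sum_le_sum fun i _ => ?_) (Nat.cast_nonneg _)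
          have := sq_sum_le_card_mul_sum_sq (s := (Finset.univ : Finset d)) (f := fun c => |ξ i c|)
          exact_mod_cast this
      _ = (Fintype.card d : ℝ) ^ 2 * ∑ i, ∑ c, ξ i c ^ 2 := by
          rw [← Finset.mul_sum, ← mul_assoc, sq, Finset.card_univ]
          simp only [sq_abs]
  by_cases hδ' : 0 ≤ δ
  · calc |gradForm ℙ ξ| ≤ δ * S ^ 2 := h1
      _ ≤ δ * ((Fintype.card d : ℝ) ^ 2 * ∑ i, ∑ c, ξ i c ^ 2) := mul_le_mul_of_nonneg_left h2 hδ'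
      _ = δ * (Fintype.card d : ℝ) ^ 2 * ∑ i, ∑ c, ξ i c ^ 2 := by ring
  · -- `δ < 0` is impossible unless there are no indices; then everything is `0`
    rcases isEmpty_or_nonempty d with he | hne
    · simp [gradForm]
    · obtain ⟨i⟩ := hne
      exact absurd ((abs_nonneg _).trans (hδ i i i i)) hδ'

/-- `viscAdjVar 𝔹 Ψ` is smooth for smooth coefficients and a smooth field (a finite sum of smooth
scalar functions times constant vectors). [cite: Giaquinta1983MultipleIntegrals, Ch. III §2 eq. (2.1)-(2.3)] -/
theorem isSmooth_viscAdjVar {𝔹 : UnitAddTorus d → Visc4 d}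
    (h𝔹 : ∀ i c j e, FunctionSpaces.Torus.IsSmooth (fun y => 𝔹 y i c j e))
    {Ψ : UnitAddTorus d → EuclideanSpace ℝ d} (hΨ : FunctionSpaces.Torus.IsSmooth Ψ) :
    FunctionSpaces.Torus.IsSmooth (viscAdjVar 𝔹 Ψ) := by
  have hc : ∀ i c j e, FunctionSpaces.Torus.IsSmooth (fun y => FunctionSpaces.Torus.partialDeriv e
      (fun y => 𝔹 y i c j e * (FunctionSpaces.Torus.partialDeriv c Ψ y) i) y) :=
    fun i c j e => (isSmooth_coeff_mul_partialDeriv h𝔹 hΨ i c j e).partialDeriv e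
  unfold FunctionSpaces.Torus.IsSmooth at hc ⊢
  exact ContDiff.sum fun j _ => (ContDiff.sum fun i _ => ContDiff.sum fun c _ =>
    ContDiff.sum fun e _ => hc i c j e).smul contDiff_const

omit [DecidableEq d] in
/-- The squared gradient norm as a double sum of squared components:
`‖∇ψ‖₂² = ∫ Σ_i Σ_c ((∂_c ψ)(x)_i)²`. [cite: Giaquinta1983MultipleIntegrals, Ch. III §2 eq. (2.2)–(2.6)] -/
theorem gradNormSq_eq_integral_sum_sum_sq [DecidableEq d] (ψ : UnitAddTorus d → EuclideanSpace ℝ d) :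
    FunctionSpaces.Torus.gradNormSq ψ = ∫ x, ∑ i, ∑ c, (FunctionSpaces.Torus.partialDeriv c ψ x) i ^ 2 := by
  unfold FunctionSpaces.Torus.gradNormSq
  refine integral_congr_ae (ae_of_all _ fun x => ?_)
  simp only [EuclideanSpace.norm_sq_eq, Real.norm_eq_abs, sq_abs]
  exact Finset.sum_comm

/-- **The perturbative Gårding inequality on divergence-free fields.** Let `𝔸` be a constant tensor
in a Legendre–Hadamard window `NearIso 𝔸 lo hi`, and `𝔹` a smooth tensor field entrywise `δ`-close to
it, `|𝔹(y) i c j e − 𝔸 i c j e| ≤ δ`. Then for every smooth DIVERGENCE-FREE `ψ`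
`∫ ⟪ψ, viscAdjVar 𝔹 ψ⟫ ≤ −(lo − (card d)² δ) ‖∇ψ‖₂²`: Fourier Gårding for the constant part
(`integral_inner_viscAdj_self_le`), the energy-form identity and the pointwise bound
`|E_{𝔹−𝔸}(ξ)| ≤ δ (card d)² |ξ|²` for the perturbation.
[cite: Giaquinta1983MultipleIntegrals, Ch. III §2 eq. (2.2)–(2.6)] [cite: LionsMagenes1972, Chap. 3 §4.3 (4.19)–(4.21)] -/
theorem integral_inner_viscAdjVar_self_le {𝔸 : Visc4 d} {lo hi : ℝ} (h𝔸 : NearIso 𝔸 lo hi)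
    {𝔹 : UnitAddTorus d → Visc4 d} (h𝔹 : ∀ i c j e, FunctionSpaces.Torus.IsSmooth (fun y => 𝔹 y i c j e))
    {δ : ℝ} (hδ : ∀ y i c j e, |𝔹 y i c j e - 𝔸 i c j e| ≤ δ)
    {ψ : UnitAddTorus d → EuclideanSpace ℝ d} (hψ : FunctionSpaces.Torus.IsSmooth ψ)
    (hdiv : FunctionSpaces.Torus.IsDivFree ψ) :
    ∫ x, ⟪ψ x, viscAdjVar 𝔹 ψ x⟫_ℝ ≤
      -((lo - (Fintype.card d : ℝ) ^ 2 * δ) * FunctionSpaces.Torus.gradNormSq ψ) := by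
  set ℙ : UnitAddTorus d → Visc4 d := fun y => 𝔹 y - 𝔸 with hℙ
  have hℙs : ∀ i c j e, FunctionSpaces.Torus.IsSmooth (fun y => ℙ y i c j e) := isSmooth_coeff_sub_const h𝔹 𝔸
  have hℙδ : ∀ y i c j e, |ℙ y i c j e| ≤ δ := fun y i c j e => by
    simp only [hℙ, Pi.sub_apply]
    exact hδ y i c j e
  -- split the operator
  have hsplit : ∀ x, ⟪ψ x, viscAdjVar 𝔹 ψ x⟫_ℝ =
      ⟪ψ x, viscAdj 𝔸 ψ x⟫_ℝ + ⟪ψ x, viscAdjVar ℙ ψ x⟫_ℝ := fun x => by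
    rw [viscAdjVar_eq_viscAdj_add h𝔹 𝔸 hψ, inner_add_right]
  have i1 : Integrable (fun x => ⟪ψ x, viscAdj 𝔸 ψ x⟫_ℝ) volume :=
    (hψ.continuous.inner (isSmooth_viscAdj 𝔸 hψ).continuous).integrable_unitAddTorus
  have i2 : Integrable (fun x => ⟪ψ x, viscAdjVar ℙ ψ x⟫_ℝ) volume :=
    (hψ.continuous.inner (isSmooth_viscAdjVar hℙs hψ).continuous).integrable_unitAddTorus
  rw [integral_congr_ae (ae_of_all _ hsplit), integral_add i1 i2]
  -- constant part: Fourier Gårding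
  have hA := integral_inner_viscAdj_self_le h𝔸 hψ hdiv
  -- perturbation: energy identity and the pointwise bound
  set ξ : UnitAddTorus d → d → d → ℝ := fun x i c => (FunctionSpaces.Torus.partialDeriv c ψ x) i with hξ
  have hE : ∫ x, ⟪ψ x, viscAdjVar ℙ ψ x⟫_ℝ = -∫ x, gradForm (ℙ x) (ξ x) :=
    integral_inner_viscAdjVar_self_eq_neg_gradForm hℙs hψ
  have hcont_sq : Continuous fun x => ∑ i, ∑ c, ξ x i c ^ 2 :=
    continuous_finsetSum _ fun i _ => continuous_finsetSum _ fun c _ =>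
      (((hψ.partialDeriv c).apply i).continuous).pow 2
  have hGi : Integrable (fun x => gradForm (ℙ x) (ξ x)) volume := by
    refine Continuous.integrable_unitAddTorus ?_
    unfold gradForm
    refine continuous_finsetSum _ fun i _ => continuous_finsetSum _ fun a _ =>
      continuous_finsetSum _ fun j _ => continuous_finsetSum _ fun b _ => ?_
    exact (((hℙs i a j b).continuous).mul ((hψ.partialDeriv a).apply i).continuous).mul
      ((hψ.partialDeriv b).apply j).continuous
  have hP : -∫ x, gradForm (ℙ x) (ξ x) ≤ δ * (Fintype.card d : ℝ) ^ 2 * FunctionSpaces.Torus.gradNormSq ψ := by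
    rw [← integral_neg, gradNormSq_eq_integral_sum_sum_sq, ← integral_const_mul]
    refine integral_mono hGi.neg (hcont_sq.integrable_unitAddTorus.const_mul _) fun x => ?_
    have h1 := abs_gradForm_le_of_entry_le (hℙδ x) (ξ x)
    have h2 := neg_abs_le (gradForm (ℙ x) (ξ x))
    simp only [hξ] at h1 ⊢
    linarith
  rw [hE]
  have : -((lo - (Fintype.card d : ℝ) ^ 2 * δ) * FunctionSpaces.Torus.gradNormSq ψ) =
      -(lo * FunctionSpaces.Torus.gradNormSq ψ) + δ * (Fintype.card d : ℝ) ^ 2 * FunctionSpaces.Torus.gradNormSq ψ := by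
    ring
  rw [this]
  exact add_le_add hA hP

/-- Gårding, nonnegative window: if moreover `(card d)² δ ≤ lo` then `∫ ⟪ψ, viscAdjVar 𝔹 ψ⟫ ≤ 0` on
smooth divergence-free `ψ` (the viscous term of the variable-tensor weak form is dissipative).
[cite: Giaquinta1983MultipleIntegrals, Ch. III §2 eq. (2.2)–(2.6)] -/
theorem integral_inner_viscAdjVar_self_nonpos {𝔸 : Visc4 d} {lo hi : ℝ} (h𝔸 : NearIso 𝔸 lo hi)
    {𝔹 : UnitAddTorus d → Visc4 d} (h𝔹 : ∀ i c j e, FunctionSpaces.Torus.IsSmooth (fun y => 𝔹 y i c j e))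
    {δ : ℝ} (hδ : ∀ y i c j e, |𝔹 y i c j e - 𝔸 i c j e| ≤ δ) (hlo : (Fintype.card d : ℝ) ^ 2 * δ ≤ lo)
    {ψ : UnitAddTorus d → EuclideanSpace ℝ d} (hψ : FunctionSpaces.Torus.IsSmooth ψ)
    (hdiv : FunctionSpaces.Torus.IsDivFree ψ) :
    ∫ x, ⟪ψ x, viscAdjVar 𝔹 ψ x⟫_ℝ ≤ 0 :=
  (integral_inner_viscAdjVar_self_le h𝔸 h𝔹 hδ hψ hdiv).trans
    (neg_nonpos.2 (mul_nonneg (sub_nonneg.2 hlo) (FunctionSpaces.Torus.gradNormSq_nonneg _)))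

/-- **Space–time form**: for a time-dependent smooth tensor field `𝔹 t` entrywise `δ`-close to a
constant Legendre–Hadamard tensor with `(card d)² δ ≤ lo` at every time, the viscous term of the
variable-tensor weak form is dissipative on divergence-free space–time tests:
`∫_{(0,T)} ∫ ⟪ψ(t), viscAdjVar (𝔹 t) (ψ t)⟫ ≤ 0`. [cite: LionsMagenes1972, Chap. 3 §4.3 (4.19)–(4.21)] -/
theorem setIntegral_integral_inner_viscAdjVar_self_nonpos {𝔸 : Visc4 d} {lo hi : ℝ} (h𝔸 : NearIso 𝔸 lo hi)
    {𝔹 : ℝ → UnitAddTorus d → Visc4 d}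
    (h𝔹 : ∀ t i c j e, FunctionSpaces.Torus.IsSmooth (fun y => 𝔹 t y i c j e))
    {δ : ℝ} (hδ : ∀ t y i c j e, |𝔹 t y i c j e - 𝔸 i c j e| ≤ δ) (hlo : (Fintype.card d : ℝ) ^ 2 * δ ≤ lo)
    {T : ℝ} {ψ : ℝ → UnitAddTorus d → EuclideanSpace ℝ d}
    (hψ : FunctionSpaces.Torus.IsSpaceTimeTest T ψ) (hψdiv : FunctionSpaces.Torus.IsDivFreeTest ψ) :
    ∫ t in Ioo 0 T, ∫ x, ⟪ψ t x, viscAdjVar (𝔹 t) (ψ t) x⟫_ℝ ≤ 0 :=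
  setIntegral_nonpos measurableSet_Ioo fun t _ =>
    integral_inner_viscAdjVar_self_nonpos h𝔸 (h𝔹 t) (hδ t) hlo (hψ.isSmooth_slice t) (hψdiv t)

end Garding

end Torus

end Literature.Analysis.FluidPDE

end
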